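import Literature.Geometry.Lorentzian.CoordShrinkerCovRmDrift
import HarnessLib

/-!
# Line `collapsed-ends-usc` of crux `EntropyRung.NoncompactShrinkerGap`: stub `helper_mwCovRmDriftChartGen`

Lead c14 of the crux line (item stmt-SmoothPoincare4-10868), programme "Munteanu–Wang 2015,
Thm. 1.4" (a complete four-dimensional gradient shrinker with bounded scalar curvature has bounded
curvature together with its first covariant derivative), brick 1 of route item 16588 (splitting at
infinity). The registered stub `helper_mwCovRmDriftChartGen` is the pointwise chart inequality
behind the second half of the proof of Munteanu–Wang's Thm. 1.4 (p. 6: "`Δ_f|∇Rm| ≥ −c|∇Rm|`",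
"`Δ_f(|∇Rm| + |Rm|²) ≥ (|∇Rm| + |Rm|²)² − c`"), in the smooth variant `w = √(|∇Rm|² + 1) + |Rm|²`
and with explicit constants: on a normalised gradient shrinker `Ric + Hess f = ½ G` in a chart
(metric components `G` on `V`, positive definite at `x`), in a basis `b` of the model space (any
finite index type), GIVEN at `x` the conclusions of the sibling stubs — the `|Rm|²` drift inequality
`Δ_f|Rm|² ≥ 2|∇Rm|² − C₅(|Rm| + 1)|Rm|²` and the `|∇Rm|²` drift inequality
`Δ_f|∇Rm|² ≥ 2|∇∇Rm|² + 3|∇Rm|² − C₁(|Rm| + 1)|∇Rm|²` with Kato `|∇|∇Rm|²|² ≤ 4|∇Rm|²|∇∇Rm|²` — and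
the curvature bound `|Rm|² ≤ K₀` (first half of Thm. 1.4):

  `Δ_f w ≥ ½ w² − (2 + 2K₀² + C₅(√K₀ + 1)K₀ + C₁²(√K₀ + 1)²)`.

It is the Literature theorem
`Literature.Geometry.Lorentzian.MetricCoord.IsMetricOn.mw_drift_sqrt_covRmNormSq_add_rmNormSqAt`
(`CoordShrinkerCovRmDrift.lean`: local chain rule for `√(t+1)`, linearity of the drift Laplacian,
and the real arithmetic of the proof), applied with `W = ♯df`; the hypotheses
`ContDiffOn ℝ ∞ f V`, the soliton equation, `0 ≤ K₀` and the two nonnegativity conjuncts are not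
used beyond the displayed inputs.

## References

* O. Munteanu, J. Wang, *Geometry of shrinking Ricci solitons*, Compositio Math. 151 (2015)
  = arXiv:1410.3813, Thm. 1.4 and its proof (p. 6). [MunteanuWang2015]
-/

noncomputable section

-- `Summit.SmoothPoincare4.SmoothPoincare4.…` (summit = problem) trips `dupNamespace` on every decl.
set_option linter.dupNamespace false

open scoped ContDiff Topology
open Set Filter Module
open Literature.Geometry.Lorentzian

namespace Summit.SmoothPoincare4.SmoothPoincare4.Theorems.NoncompactShrinkerGapMW

/-- **Stub `helper_mwCovRmDriftChartGen` (Munteanu–Wang 2015, Thm. 1.4, second half, at a point,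
PROVED)**: on a normalised gradient shrinker in a chart (metric components `G` on `V`, positive
definite at `x ∈ V`), in a basis `b` of the model space, given the `|Rm|²` drift inequality with
constant `C₅ ≥ 0`, the `|∇Rm|²` drift inequality with constant `C₁ ≥ 0` and its Kato inequality,
and `|Rm|² ≤ K₀` at `x`: for `w = √(|∇Rm|² + 1) + |Rm|²`,
`½ w² − (2 + 2K₀² + C₅(√K₀+1)K₀ + C₁²(√K₀+1)²) ≤ Δw − dw(♯Df)`.
[cite: MunteanuWang2015, Thm. 1.4 (proof)] -/
theorem helper_mwCovRmDriftChartGen : ∀ {E : Type} [NormedAddCommGroup E] [NormedSpace ℝ E] [FiniteDimensional ℝ E] [CompleteSpace E] (G : E → E →L[ℝ] E →L[ℝ] ℝ) (V : Set E) (x : E) (f : E → ℝ) {ι : Type} [Fintype ι] [DecidableEq ι] (b : Module.Basis ι ℝ E) (C₁ C₅ K₀ : ℝ), MetricCoord.IsMetricOn G V → x ∈ V → (∀ v : E, v ≠ 0 → 0 < G x v v) → ContDiffOn ℝ ∞ f V → (∀ y ∈ V, ∀ v w : E, MetricCoord.ricAt G y v w + MetricCoord.hessAt G f y v w = (1 /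 2 : ℝ) * G y v w) → 0 ≤ C₁ → 0 ≤ C₅ → 0 ≤ K₀ → MetricCoord.rmNormSqAt G x ≤ K₀ → 2 * MetricCoord.tnormSq G b (MetricCoord.tcov G b (MetricCoord.rm4 G b)) x - C₅ * (Real.sqrt (MetricCoord.rmNormSqAt G x) + 1) * MetricCoord.rmNormSqAt G x ≤ MetricCoord.lapAt G (MetricCoord.rmNormSqAt G) x - fderiv ℝ (MetricCoord.rmNormSqAt G) x (MetricCoord.sharpAt G x (fderiv ℝ f x)) → (2 * MetricCoord.tnormSq G b (MetricCoord.tcov G b (MetricCoord.tcov G b (MetricCoord.rm4 G b))) x + 3 * MetricCoord.tnormSq G b (MetricCoord.tcov G b (MetricCoord.rm4 G b)) x - C₁ * (Real.sqrt (MetricCoord.rmNormSqAt G x) + 1) * MetricCoord.tnormSq G b (MetricCoord.tcov G b (MetricCoord.rm4 G b)) x ≤ MetricCoord.lapAt G (MetricCoord.tnormSq G b (MetricCoord.tcov G b (MetricCoord.rm4 G b))) x - fderiv ℝ (MetricCoord.tnormSq G b (MetricCoord.tcov G b (MetricCoord.rm4 G b))) x (MetricCoord.sharpAt G x (fderiv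 ℝ f x)) ∧ MetricCoord.gradSqAt G (MetricCoord.tnormSq G b (MetricCoord.tcov G b (MetricCoord.rm4 G b))) x ≤ 4 * MetricCoord.tnormSq G b (MetricCoord.tcov G b (MetricCoord.rm4 G b)) x * MetricCoord.tnormSq G b (MetricCoord.tcov G b (MetricCoord.tcov G b (MetricCoord.rm4 G b))) x ∧ 0 ≤ MetricCoord.tnormSq G b (MetricCoord.tcov G b (MetricCoord.rm4 G b)) x ∧ 0 ≤ MetricCoord.tnormSq G b (MetricCoord.tcov G b (MetricCoord.tcov G b (MetricCoord.rm4 G b))) x) → 1 / 2 * ((MetricCoord.tnormSq G b (MetricCoord.tcov G b (MetricCoord.rm4 G b)) x + 1) ^ ((1 / 2 : ℝ)) + MetricCoord.rmNormSqAt G x) ^ 2 - (2 + 2 * K₀ ^ 2 + C₅ * (Real.sqrt K₀ + 1) * K₀ + C₁ ^ 2 * (Real.sqrt K₀ + 1) ^ 2) ≤ MetricCoord.lapAt G (fun y ↦ (MetricCoord.tnormSq G b (MetricCoord.tcov G b (MetricCoord.rm4 G b)) y + 1) ^ ((1 / 2 : ℝ)) + MetricCoord.rmNormSqAt G y) x -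 fderiv ℝ (fun y ↦ (MetricCoord.tnormSq G b (MetricCoord.tcov G b (MetricCoord.rm4 G b)) y + 1) ^ ((1 / 2 : ℝ)) + MetricCoord.rmNormSqAt G y) x (MetricCoord.sharpAt G x (fderiv ℝ f x)) := by
  intro E _ _ _ _ G V x f ι _ _ b C₁ C₅ K₀ hG hx hpos _ _ hC₁ hC₅ _ hMK hRm hCov
  exact hG.mw_drift_sqrt_covRmNormSq_add_rmNormSqAt hx hpos (MetricCoord.sharpAt G x (fderiv ℝ f x)) b
    hC₁ hC₅ hMK hRm hCov.1 hCov.2.1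

end Summit.SmoothPoincare4.SmoothPoincare4.Theorems.NoncompactShrinkerGapMW

end
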